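import Literature.Geometry.DiscreteGeometry.TwoShellPatterns

/-!
# `OverbindingBudget` / crux `RobustDefectLimitWindows` (stmt-AtomisticToContinuum-31280) — «RunCut»: the CHIRALITY AMPLITUDE CAP `3/4`

Support file (lens-4 g86, hand-in 3 part 0; memo `g86/memo/SW-G1.md` §9; the «provable constant» of the chirality budget line owed since
critic row 1526, re-derived: g85's `0.385` is NOT an upper bound — the sharp maxima over the actual chart ball are `0.6917` (fcc pattern) /
`0.6495` (hcp), `numerics/chirality_max.py`).

THE TERM.  Per flipped adjacent pair the `k = 1` class-exchange energy carries, at second order in the chart strain, ONE bilinear invariant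
(C₃ covariance + the class-exchanging mirror): `D₁ = κ(a)·F(E)`, `F(E) = (e₁₁ − e₂₂)·e₂₃ + 2·e₁₂·e₁₃` in the layer frame (`e₃` = layer normal;
g85's normalisation `s = (e₁₁−e₂₂)/2`, `γ = 2|(e₁₃, e₂₃)|`, `D₁ ≤ κ·s·γ`), where `E` is the SYMMETRIC part of the chart defect `C = Fᵀ (A − Q) F` written
in the layer frame `F` (an orthogonal change of coordinates from the pattern frame).  THE CONSTRAINT is that of `AffFramed ε θ g`: `‖(A − Q) v‖ ≤ θ`
for the 18 two-shell pattern vectors `v`; this file uses only the SIX SECOND-SHELL vectors, whose second moment is isotropic,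
`∑_v v vᵀ = 4·I` for BOTH patterns (`fccSecondShellInt`: `(±2,0,0),…` at scale `√2`; `hcpSecondShellInt`: `(6,0,0),…,(2,−4,−4),…` at scale `√18`;
§4, `decide` over `ℤ`).
THE CAP (★ `chirality_cap`): `|F(E)| ≤ (3/4)·θ²`.  Proof: `|F(E)| ≤ ½‖E‖²_F` (§1, the SOS identity
`½‖E‖²_F − F(E) = ½(e₁₁−e₂₃)² + ½(e₂₂+e₂₃)² + (e₁₂−e₁₃)² + ½e₃₃²`); `‖E‖_F ≤ ‖C‖_F` (§1, symmetrisation); `‖C‖_F = ‖A − Q‖_F` (§2, orthogonal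
frame change, `tr`-cyclicity); `‖B‖²_F = ¼∑_{2nd shell}‖B v‖² ≤ (6/4)θ²` (§3, the moment identity).  Everything is stated on `Matrix (Fin 3) (Fin 3) ℝ`
with explicit coordinate sums (`∑ i, ∑ j, B i j ^ 2`), so hand-in 3's Taylor link can instantiate it in whatever frame formalism it adopts.
Budget consequence (memo §9): chirality line `3κ·(3/4)·θ₀²` per column (was `3κ·0.385·θ₀²`), charged against the WINDOW-certified gains.
[this file: 0 definitions, 13 theorems; Mathlib + Literature `TwoShellPatterns` only; standard axioms]
-/

namespace Summit.AtomisticToContinuum.Crystallization.Theorems.OverbindingBudgetAffineRunCutChiralityCap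

open Finset Matrix
open Literature.Geometry.DiscreteGeometry (fccSecondShellInt hcpSecondShellInt)

/-! ## §1. The form against the Frobenius norm (SOS), and symmetrisation -/

/-- **SOS**: `|(e₁₁ − e₂₂)e₂₃ + 2e₁₂e₁₃| ≤ ½(e₁₁² + e₂₂² + e₃₃² + 2e₁₂² + 2e₁₃² + 2e₂₃²) = ½‖E‖²_F`. [this file · kind: proof] -/
theorem abs_chiralityForm_le (e11 e22 e33 e12 e13 e23 : ℝ) :
    |(e11 - e22) * e23 + 2 * (e12 * e13)| ≤ (e11 ^ 2 + e22 ^ 2 + e33 ^ 2 + 2 * e12 ^ 2 + 2 * e13 ^ 2 + 2 * e23 ^ 2) / 2 := by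
  rw [abs_le]
  constructor
  · nlinarith [sq_nonneg (e11 + e23), sq_nonneg (e22 - e23), sq_nonneg (e12 + e13), sq_nonneg e33]
  · nlinarith [sq_nonneg (e11 - e23), sq_nonneg (e22 + e23), sq_nonneg (e12 - e13), sq_nonneg e33]

/-- The cap from a Frobenius bound on the (not necessarily symmetric) layer-frame defect `C`, the form being evaluated on its symmetric
part `E = (C + Cᵀ)/2`: `∑ C_ij² ≤ (3/2)θ² ⇒ |F(E)| ≤ (3/4)θ²`. [this file · kind: proof] -/
theorem chirality_cap_of_sum_sq (C : Matrix (Fin 3) (Fin 3) ℝ) {θ : ℝ} (hC : ∑ i, ∑ j, C i j ^ 2 ≤ 3 / 2 * θ ^ 2) :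
    |(C 0 0 - C 1 1) * ((C 1 2 + C 2 1) / 2) + 2 * (((C 0 1 + C 1 0) / 2) * ((C 0 2 + C 2 0) / 2))| ≤ 3 / 4 * θ ^ 2 := by
  simp only [Fin.sum_univ_three] at hC
  have h := abs_chiralityForm_le (C 0 0) (C 1 1) (C 2 2) ((C 0 1 + C 1 0) / 2) ((C 0 2 + C 2 0) / 2) ((C 1 2 + C 2 1) / 2)
  nlinarith [sq_nonneg (C 0 1 - C 1 0), sq_nonneg (C 0 2 - C 2 0), sq_nonneg (C 1 2 - C 2 1)]

/-! ## §2. Frobenius norm: trace form and invariance under an orthogonal change of frame -/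

/-- `∑ M_ij² = tr(Mᵀ M)`. [folklore] -/
theorem sum_sq_eq_trace (M : Matrix (Fin 3) (Fin 3) ℝ) : ∑ i, ∑ j, M i j ^ 2 = (Mᵀ * M).trace := by
  simp only [Matrix.trace, Matrix.diag_apply, Matrix.mul_apply, Matrix.transpose_apply, sq]
  exact Finset.sum_comm

/-- **Frame change**: for `Fᵀ F = 1`, `∑ (Fᵀ B F)_ij² = ∑ B_ij²`. [folklore] -/
theorem sum_sq_frame (B F : Matrix (Fin 3) (Fin 3) ℝ) (hF : Fᵀ * F = 1) :
    ∑ i, ∑ j, (Fᵀ * B * F) i j ^ 2 = ∑ i, ∑ j, B i j ^ 2 := by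
  have hF' : F * Fᵀ = 1 := mul_eq_one_comm.1 hF
  rw [sum_sq_eq_trace, sum_sq_eq_trace]
  have h1 : (Fᵀ * B * F)ᵀ * (Fᵀ * B * F) = Fᵀ * (Bᵀ * B * F) := by
    rw [Matrix.transpose_mul, Matrix.transpose_mul, Matrix.transpose_transpose]
    calc Fᵀ * (Bᵀ * Fᵀᵀ) * (Fᵀ * B * F) = Fᵀ * Bᵀ * (F * Fᵀ) * B * F := by
          rw [Matrix.transpose_transpose]; simp only [Matrix.mul_assoc]
      _ = Fᵀ * (Bᵀ * B * F) := by rw [hF']; simp only [Matrix.mul_one, Matrix.mul_assoc]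
  rw [h1, Matrix.trace_mul_comm, Matrix.mul_assoc, hF', Matrix.mul_one]

/-! ## §3. The second-shell moment identity and the Frobenius bound from the chart constraint -/

/-- **Moment identity**: if `∑_{k∈S} v_k v_kᵀ = 4·I` then `∑_{k∈S} ‖B v_k‖² = 4‖B‖²_F` (coordinates). [folklore] -/
theorem sum_normSq_eq_four_mul {σ : Type*} (S : Finset σ) (v : σ → Fin 3 → ℝ) (B : Matrix (Fin 3) (Fin 3) ℝ)
    (hM : ∀ j j' : Fin 3, ∑ k ∈ S, v k j * v k j' = if j = j' then 4 else 0) :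
    ∑ k ∈ S, ∑ i, (∑ j, B i j * v k j) ^ 2 = 4 * ∑ i, ∑ j, B i j ^ 2 := by
  have key : ∀ i, ∑ k ∈ S, (∑ j, B i j * v k j) ^ 2 = ∑ j, ∑ j', B i j * B i j' * ∑ k ∈ S, v k j * v k j' := by
    intro i
    calc ∑ k ∈ S, (∑ j, B i j * v k j) ^ 2 = ∑ k ∈ S, ∑ j, ∑ j', (B i j * v k j) * (B i j' * v k j') := by
          refine Finset.sum_congr rfl fun k _ => ?_
          rw [sq, Finset.sum_mul_sum]
      _ = ∑ j, ∑ k ∈ S, ∑ j', (B i j * v k j) * (B i j' * v k j') := Finset.sum_comm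
      _ = ∑ j, ∑ j', ∑ k ∈ S, (B i j * v k j) * (B i j' * v k j') := by
          refine Finset.sum_congr rfl fun j _ => Finset.sum_comm
      _ = ∑ j, ∑ j', B i j * B i j' * ∑ k ∈ S, v k j * v k j' := by
          refine Finset.sum_congr rfl fun j _ => Finset.sum_congr rfl fun j' _ => ?_
          rw [Finset.mul_sum]
          exact Finset.sum_congr rfl fun k _ => by ring
  rw [Finset.sum_comm]
  simp_rw [key, hM, mul_ite, mul_zero, Finset.sum_ite_eq, Finset.mem_univ, if_true]
  rw [Finset.mul_sum]
  refine Finset.sum_congr rfl fun i _ => ?_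
  rw [Finset.mul_sum]
  exact Finset.sum_congr rfl fun j _ => by ring

/-- **Frobenius bound from the chart constraint on an isotropic shell of six vectors**: `‖B v_k‖² ≤ θ²` (`k ∈ S`, `#S = 6`,
`∑ v_k v_kᵀ = 4I`) ⇒ `∑ B_ij² ≤ (3/2)θ²`. [this file · kind: proof] -/
theorem sum_sq_le_of_shell {σ : Type*} (S : Finset σ) (v : σ → Fin 3 → ℝ) (B : Matrix (Fin 3) (Fin 3) ℝ)
    (hM : ∀ j j' : Fin 3, ∑ k ∈ S, v k j * v k j' = if j = j' then 4 else 0) (hS : S.card = 6) {θ : ℝ}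
    (hB : ∀ k ∈ S, ∑ i, (∑ j, B i j * v k j) ^ 2 ≤ θ ^ 2) : ∑ i, ∑ j, B i j ^ 2 ≤ 3 / 2 * θ ^ 2 := by
  have h4 := sum_normSq_eq_four_mul S v B hM
  have hs : ∑ k ∈ S, ∑ i, (∑ j, B i j * v k j) ^ 2 ≤ ∑ _k ∈ S, θ ^ 2 := Finset.sum_le_sum hB
  rw [Finset.sum_const, hS, nsmul_eq_mul] at hs
  push_cast at hs
  linarith

/-- From the integer model: vectors `w ∈ T ⊆ ℤ³` with `∑_w w_j w_j' = 4N·δ_jj'` give, at scale `(√N)⁻¹`, the moment `4·I`. [folklore] -/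
theorem moment_of_int (T : Finset (Fin 3 → ℤ)) {N : ℕ} (hN : N ≠ 0)
    (hT : ∀ j j' : Fin 3, ∑ w ∈ T, w j * w j' = if j = j' then 4 * (N : ℤ) else 0) (j j' : Fin 3) :
    ∑ w ∈ T, ((Real.sqrt N)⁻¹ * (w j : ℝ)) * ((Real.sqrt N)⁻¹ * (w j' : ℝ)) = if j = j' then 4 else 0 := by
  have hN' : (0 : ℝ) < N := by exact_mod_cast Nat.pos_of_ne_zero hN
  have hs : (Real.sqrt N)⁻¹ * (Real.sqrt N)⁻¹ = (N : ℝ)⁻¹ := by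
    rw [← mul_inv, Real.mul_self_sqrt hN'.le]
  have h := hT j j'
  have h' : ∑ w ∈ T, ((w j : ℝ)) * (w j' : ℝ) = if j = j' then 4 * (N : ℝ) else 0 := by
    have := congrArg (fun z : ℤ => (z : ℝ)) h
    simpa [Int.cast_sum, Int.cast_mul, Int.cast_ite] using this
  calc ∑ w ∈ T, ((Real.sqrt N)⁻¹ * (w j : ℝ)) * ((Real.sqrt N)⁻¹ * (w j' : ℝ))
      = (N : ℝ)⁻¹ * ∑ w ∈ T, (w j : ℝ) * (w j' : ℝ) := by
        rw [Finset.mul_sum]; exact Finset.sum_congr rfl fun w _ => by rw [← hs]; ring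
    _ = if j = j' then 4 else 0 := by
        rw [h']
        split_ifs
        · field_simp
        · simp

/-! ## §4. The two second shells are isotropic (`decide` over `ℤ`) -/

/-- fcc second shell `(±2,0,0),(0,±2,0),(0,0,±2)` (scale `√2`): `∑ w_j w_j' = 8·δ_jj'`. [folklore] -/
theorem fccSecondShellInt_moment : ∀ j j' : Fin 3, ∑ w ∈ fccSecondShellInt, w j * w j' = if j = j' then 4 * ((2 : ℕ) : ℤ) else 0 := by
  decide

/-- hcp second shell `(6,0,0),(0,6,0),(0,0,6),(2,−4,−4),(−4,2,−4),(−4,−4,2)` (scale `√18`): `∑ w_j w_j' = 72·δ_jj'`. [folklore] -/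
theorem hcpSecondShellInt_moment : ∀ j j' : Fin 3, ∑ w ∈ hcpSecondShellInt, w j * w j' = if j = j' then 4 * ((18 : ℕ) : ℤ) else 0 := by
  decide

/-- Six vectors each. [folklore] -/
theorem card_secondShellInt : fccSecondShellInt.card = 6 ∧ hcpSecondShellInt.card = 6 := by decide

/-! ## §5. ★ The cap -/

/-- ★ **CHIRALITY AMPLITUDE CAP.**  Let `B` be the chart defect in pattern coordinates (`A − Q` as a matrix), `F` an orthogonal change to the
layer frame (`Fᵀ F = 1`), `C = Fᵀ B F`, and let the chart constraint hold on an isotropic shell of six pattern vectors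
(`∑ v vᵀ = 4I`, `‖B v‖² ≤ θ²` each — the second shell of `AffFramed`).  Then the chirality form of the symmetric part of `C` is at most
`(3/4)·θ²`: `|(C₀₀ − C₁₁)·sym(C)₁₂ + 2·sym(C)₀₁·sym(C)₀₂| ≤ (3/4)θ²`.  (Sharp value over the full 18-vector ball: `0.6917θ²` fcc / `0.6495θ²`
hcp, numerically; `3/4` is the second-shell-only certificate.) [this file · kind: proof] -/
theorem chirality_cap {σ : Type*} (S : Finset σ) (v : σ → Fin 3 → ℝ) (B F : Matrix (Fin 3) (Fin 3) ℝ) (hF : Fᵀ * F = 1)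
    (hM : ∀ j j' : Fin 3, ∑ k ∈ S, v k j * v k j' = if j = j' then 4 else 0) (hS : S.card = 6) {θ : ℝ}
    (hB : ∀ k ∈ S, ∑ i, (∑ j, B i j * v k j) ^ 2 ≤ θ ^ 2) :
    |((Fᵀ * B * F) 0 0 - (Fᵀ * B * F) 1 1) * (((Fᵀ * B * F) 1 2 + (Fᵀ * B * F) 2 1) / 2)
      + 2 * ((((Fᵀ * B * F) 0 1 + (Fᵀ * B * F) 1 0) / 2) * (((Fᵀ * B * F) 0 2 + (Fᵀ * B * F) 2 0) / 2))| ≤ 3 / 4 * θ ^ 2 := by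
  apply chirality_cap_of_sum_sq
  rw [sum_sq_frame B F hF]
  exact sum_sq_le_of_shell S v B hM hS hB

/-- ★ **fcc instance**: the cap under the six fcc second-shell constraints `‖B((√2)⁻¹·w)‖² ≤ θ²`, `w ∈ fccSecondShellInt`. [this file · kind: proof] -/
theorem chirality_cap_fcc (B F : Matrix (Fin 3) (Fin 3) ℝ) (hF : Fᵀ * F = 1) {θ : ℝ}
    (hB : ∀ w ∈ fccSecondShellInt, ∑ i, (∑ j, B i j * ((Real.sqrt (2 : ℕ))⁻¹ * (w j : ℝ))) ^ 2 ≤ θ ^ 2) :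
    |((Fᵀ * B * F) 0 0 - (Fᵀ * B * F) 1 1) * (((Fᵀ * B * F) 1 2 + (Fᵀ * B * F) 2 1) / 2)
      + 2 * ((((Fᵀ * B * F) 0 1 + (Fᵀ * B * F) 1 0) / 2) * (((Fᵀ * B * F) 0 2 + (Fᵀ * B * F) 2 0) / 2))| ≤ 3 / 4 * θ ^ 2 :=
  chirality_cap fccSecondShellInt (fun w j => (Real.sqrt (2 : ℕ))⁻¹ * (w j : ℝ)) B F hF
    (moment_of_int fccSecondShellInt (by norm_num) fccSecondShellInt_moment) card_secondShellInt.1 hB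

/-- ★ **hcp instance**: the cap under the six hcp second-shell constraints `‖B((√18)⁻¹·w)‖² ≤ θ²`, `w ∈ hcpSecondShellInt`. [this file · kind: proof] -/
theorem chirality_cap_hcp (B F : Matrix (Fin 3) (Fin 3) ℝ) (hF : Fᵀ * F = 1) {θ : ℝ}
    (hB : ∀ w ∈ hcpSecondShellInt, ∑ i, (∑ j, B i j * ((Real.sqrt (18 : ℕ))⁻¹ * (w j : ℝ))) ^ 2 ≤ θ ^ 2) :
    |((Fᵀ * B * F) 0 0 - (Fᵀ * B * F) 1 1) * (((Fᵀ * B * F) 1 2 + (Fᵀ * B * F) 2 1) / 2)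
      + 2 * ((((Fᵀ * B * F) 0 1 + (Fᵀ * B * F) 1 0) / 2) * (((Fᵀ * B * F) 0 2 + (Fᵀ * B * F) 2 0) / 2))| ≤ 3 / 4 * θ ^ 2 :=
  chirality_cap hcpSecondShellInt (fun w j => (Real.sqrt (18 : ℕ))⁻¹ * (w j : ℝ)) B F hF
    (moment_of_int hcpSecondShellInt (by norm_num) hcpSecondShellInt_moment) card_secondShellInt.2 hB

end Summit.AtomisticToContinuum.Crystallization.Theorems.OverbindingBudgetAffineRunCutChiralityCap
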